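import Mathlib
import Summits.RiemannHypothesis.Statement
import Summits.RiemannHypothesis.RiemannHypothesis.Theorems.DeBrangesChainDefs
import Summits.RiemannHypothesis.RiemannHypothesis.Theorems.DeBrangesChainSeparation
import Summits.RiemannHypothesis.RiemannHypothesis.Theorems.DeBrangesChainDoor
import Summits.RiemannHypothesis.RiemannHypothesis.Theorems.DeBrangesChainDoorWeilSign
import Summits.RiemannHypothesis.RiemannHypothesis.Theorems.DeBrangesChainConverse
import Literature.NumberTheory.LFunctions.SuzukiWeilHilbertSpaceDefs
import Literature.NumberTheory.LFunctions.WeilZeroSum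
import Literature.NumberTheory.LFunctions.ZetaLogDerivRH
import Literature.Analysis.UnboundedOperators.HilbertPolyaProofs
import HarnessLib

/-!
# Costume detectors — dbr, OFF-LINE cut of Suzuki's conjunct (2) (cell rh-split, seat dbr/neg gen 8; ZERO new `def`s)

BOOKKEEPING about the RH-EQUIVALENCE X-2 = `IsolatedV0 := WeilNormIdentityOn (suzukiV 0) ∧ ZeroSeparationOn (suzukiV 0)`
([Su25c] Thm 1.3 / CJM Prop. 5.8; tree `DeBrangesChain.riemannHypothesis_iff_isolatedV0`,
`Splittings.CostumeDetectorsHeight.rh_iff_normIdentity_and_separation`).  The printed sufficiency proof (§3.4, p. 7: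
«We take a non-real γ₀ ∈ Γ …») — and the tree doors `DeBrangesChain.chainDoorV0_proof`,
`DeBrangesChain.riemannHypothesis_of_weilSum_re_nonneg_of_separation` — consume conjunct (2) ONLY at the two NON-REAL
parameters `γ₀, γ̄₀` of one off-line zero.  Cutting (2) by `Re ρ ≠ 1/2` (instead of by height, cf.
`CostumeDetectorsHeight`) gives the consumed conjunct «every OFF-LINE pair is separable in `V`», which is
RH-IMPLIED BY VACUITY for every `V` (`offLinePairSeparation_of_rh`), is `RiemannHypothesis` VERBATIM on the zero space
`V = {0}` (`offLinePairSeparation_singleton_zero_iff_rh`), and makes the witness of the printed V-existential variant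
(Thm 3.1) collapse to `V = {0}` (`rh_iff_exists_normIdentityOn_and_offLinePairSeparation`); the critical-zero separation
and the uniform `δ` of the printed (2) never enter the door.  Price floor: an RH-free proof of the consumed conjunct on
`V(0)` settles Suzuki's open question `V(0) ≠ {0}` (`exists_mem_suzukiV_ne_zero_of_offLinePairSeparation`).
Everything is PROVED bookkeeping over tree declarations (std axioms); the equivalences certify nothing about RH;
`_root_.RiemannHypothesis` = `Summit.RiemannHypothesis` (`Summit.RiemannHypothesis_iff`).  Nothing here is a claim about
the truth of RH.  ZERO `def`s: the off-line pair-separation predicate is INLINED in every statement (cell convention for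
costume detectors); the scratch of record with named predicates is `pub/rh-split/rh-split-dbr-neg/SketchG8.lean`.
-/

noncomputable section

-- D-0017: `Summit.<S>.<S>.…` is the designed namespace of a single-problem summit.
set_option linter.dupNamespace false

namespace Summit.RiemannHypothesis.RiemannHypothesis.Theorems.Splittings.CostumeDetectorsDbrOffLine

open Complex Filter Set MeasureTheory
open scoped ComplexConjugate Topology
open Literature.NumberTheory.LFunctions
open Summit.RiemannHypothesis.RiemannHypothesis.Theorems.DeBrangesChain

/-! ## §1 The RH-free core: the Weil SIGN on a subtraction-closed `V` forbids separating an off-line PAIR -/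

/-- dbr, RH-FREE core of the door (no `¬RH`): on a set `V ⊆ L²(ℝ)` closed under subtraction on which every
unconditional Weil sum has nonnegative real part (dbl's weakening of conjunct (1)), NO off-line non-trivial zero `ρ₀`
admits, for some `δ > 0` and every `ε > 0`, separating witnesses at BOTH `γ₀ = γ_{ρ₀}` and `γ̄₀ = γ_{1−ρ̄₀}`.  Proof =
[Su25c] §3.4 verbatim (tree `chainDoorV0_proof`): `ψ := ψ₁ − ψ₂`, values `c₁ − c₂`, the Weil family is summable
(`summable_weilSum_of_separation`) with `Re < 0` (`weilSum_re_neg_of_separation`) and `Re ≥ 0` (sign); brief rh-split dbr.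
[cite: Suzuki2025WeilHilbertSpace, §3.4 p. 7 ("We take a non-real γ₀ ∈ Γ")] -/
theorem not_offLinePairSeparation_of_weilSign {V : Set (Lp ℂ 2 (volume : Measure ℝ))}
    (hV : ∀ f ∈ V, ∀ g ∈ V, f - g ∈ V)
    (hpos : ∀ ψ ∈ V, ∀ c : ℂ → ℂ,
      (∀ ρ ∈ ZetaZeros.riemannZetaNontrivialZeros,
          HasHatValue ψ (suzukiZeroParam ρ) (c (suzukiZeroParam ρ))) →
        ∀ S : ℂ, HasSum (fun ρ : ZetaZeros.riemannZetaNontrivialZeros ↦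
            (riemannZetaZeroOrder (ρ : ℂ) : ℂ) * c (suzukiZeroParam ρ) *
              conj (c (conj (suzukiZeroParam ρ)))) S → 0 ≤ S.re)
    {ρ₀ : ℂ} (hρ₀ : ρ₀ ∈ ZetaZeros.riemannZetaNontrivialZeros) (hoff : ρ₀.re ≠ 1 / 2)
    {δ : ℝ} (hδ : 0 < δ)
    (hsep : ∀ ε : ℝ, 0 < ε →
      (∃ ψ ∈ V, HasHatValue ψ (suzukiZeroParam ρ₀) 1 ∧
        ∀ ρ' ∈ ZetaZeros.riemannZetaNontrivialZeros, ρ' ≠ ρ₀ →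
          ∃ c : ℂ, HasHatValue ψ (suzukiZeroParam ρ') c ∧
            ‖c‖ ≤ ε / ‖suzukiZeroParam ρ₀ - suzukiZeroParam ρ'‖ ^ (1 + δ)) ∧
      (∃ ψ ∈ V, HasHatValue ψ (suzukiZeroParam (1 - conj ρ₀)) 1 ∧
        ∀ ρ' ∈ ZetaZeros.riemannZetaNontrivialZeros, ρ' ≠ 1 - conj ρ₀ →
          ∃ c : ℂ, HasHatValue ψ (suzukiZeroParam ρ') c ∧
            ‖c‖ ≤ ε / ‖suzukiZeroParam (1 - conj ρ₀) - suzukiZeroParam ρ'‖ ^ (1 + δ))) :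
    False := by
  classical
  obtain ⟨ε, hε, hneg⟩ := weilSum_re_neg_of_separation hρ₀ hoff hδ
  obtain ⟨⟨ψ₁, hψ₁V, hψ₁one, hψ₁bd⟩, ⟨ψ₂, hψ₂V, hψ₂one, hψ₂bd⟩⟩ := hsep ε hε
  choose! v₁ hv₁ hv₁b using hψ₁bd
  choose! v₂ hv₂ hv₂b using hψ₂bd
  set c₁ : ℂ → ℂ := Function.update (fun z ↦ v₁ (1 / 2 - I * z)) (suzukiZeroParam ρ₀) 1 with hc₁def
  set c₂ : ℂ → ℂ := Function.update (fun z ↦ v₂ (1 / 2 - I * z)) (suzukiZeroParam (1 - conj ρ₀)) 1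
    with hc₂def
  have hc₁₀ : c₁ (suzukiZeroParam ρ₀) = 1 := by
    simp only [hc₁def, Function.update_self]
  have hc₂₀ : c₂ (suzukiZeroParam (1 - conj ρ₀)) = 1 := by
    simp only [hc₂def, Function.update_self]
  have hc₁ : ∀ ρ : ℂ, ρ ≠ ρ₀ → c₁ (suzukiZeroParam ρ) = v₁ ρ := by
    intro ρ h
    simp only [hc₁def, Function.update_of_ne (suzukiZeroParam_injective.ne h),
      one_half_sub_I_mul_suzukiZeroParam]
  have hc₂ : ∀ ρ : ℂ, ρ ≠ 1 - conj ρ₀ → c₂ (suzukiZeroParam ρ) = v₂ ρ := by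
    intro ρ h
    simp only [hc₂def, Function.update_of_ne (suzukiZeroParam_injective.ne h),
      one_half_sub_I_mul_suzukiZeroParam]
  have hψV : ψ₁ - ψ₂ ∈ V := hV ψ₁ hψ₁V ψ₂ hψ₂V
  have hvals : ∀ ρ ∈ ZetaZeros.riemannZetaNontrivialZeros,
      HasHatValue (ψ₁ - ψ₂) (suzukiZeroParam ρ)
        ((fun z ↦ c₁ z - c₂ z) (suzukiZeroParam ρ)) := by
    intro ρ hρ
    refine hasHatValue_sub ?_ ?_
    · by_cases h : ρ = ρ₀
      · rw [h, hc₁₀]; exact hψ₁one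
      · rw [hc₁ ρ h]; exact hv₁ ρ hρ h
    · by_cases h : ρ = 1 - conj ρ₀
      · rw [h, hc₂₀]; exact hψ₂one
      · rw [hc₂ ρ h]; exact hv₂ ρ hρ h
  have hb1 : ∀ ρ ∈ ZetaZeros.riemannZetaNontrivialZeros, ρ ≠ ρ₀ →
      ‖c₁ (suzukiZeroParam ρ)‖ ≤ ε / ‖suzukiZeroParam ρ₀ - suzukiZeroParam ρ‖ ^ (1 + δ) := by
    intro ρ hρ h; rw [hc₁ ρ h]; exact hv₁b ρ hρ h
  have hb2 : ∀ ρ ∈ ZetaZeros.riemannZetaNontrivialZeros, ρ ≠ 1 - conj ρ₀ →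
      ‖c₂ (suzukiZeroParam ρ)‖ ≤
        ε / ‖suzukiZeroParam (1 - conj ρ₀) - suzukiZeroParam ρ‖ ^ (1 + δ) := by
    intro ρ hρ h; rw [hc₂ ρ h]; exact hv₂b ρ hρ h
  have h2 : c₂ (conj (suzukiZeroParam ρ₀)) = 1 := by
    rw [← suzukiZeroParam_one_sub_conj]; exact hc₂₀
  have hsumm := summable_weilSum_of_separation hρ₀ hδ.le ε c₁ c₂ hb1 hb2
  have hlt := hneg c₁ c₂ hc₁₀ h2 hb1 hb2 _ hsumm.hasSum
  have hge := hpos (ψ₁ - ψ₂) hψV (fun z ↦ c₁ z - c₂ z) hvals _ hsumm.hasSum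
  exact absurd hge (not_le.mpr hlt)

/-- dbr, THE MINIMAL DOOR (V-general, raw): Weil sign on a subtraction-closed `V` ∧ «every OFF-LINE pair is separable
in `V`» ⟹ RH.  Conjunct (2) of [Su25c] Thm 1.3 / 3.1 enters the door only through this off-line part; brief rh-split
dbr. [cite: Suzuki2025WeilHilbertSpace, Thm. 3.1 pp. 7–8; §3.4 p. 7] -/
theorem rh_of_weilSign_of_offLinePairSeparation {V : Set (Lp ℂ 2 (volume : Measure ℝ))}
    (hV : ∀ f ∈ V, ∀ g ∈ V, f - g ∈ V)
    (hpos : ∀ ψ ∈ V, ∀ c : ℂ → ℂ,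
      (∀ ρ ∈ ZetaZeros.riemannZetaNontrivialZeros,
          HasHatValue ψ (suzukiZeroParam ρ) (c (suzukiZeroParam ρ))) →
        ∀ S : ℂ, HasSum (fun ρ : ZetaZeros.riemannZetaNontrivialZeros ↦
            (riemannZetaZeroOrder (ρ : ℂ) : ℂ) * c (suzukiZeroParam ρ) *
              conj (c (conj (suzukiZeroParam ρ)))) S → 0 ≤ S.re)
    (hB : ∀ ρ₀ ∈ ZetaZeros.riemannZetaNontrivialZeros, ρ₀.re ≠ 1 / 2 →
      ∃ δ : ℝ, 0 < δ ∧ ∀ ε : ℝ, 0 < ε →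
        (∃ ψ ∈ V, HasHatValue ψ (suzukiZeroParam ρ₀) 1 ∧
          ∀ ρ' ∈ ZetaZeros.riemannZetaNontrivialZeros, ρ' ≠ ρ₀ →
            ∃ c : ℂ, HasHatValue ψ (suzukiZeroParam ρ') c ∧
              ‖c‖ ≤ ε / ‖suzukiZeroParam ρ₀ - suzukiZeroParam ρ'‖ ^ (1 + δ)) ∧
        (∃ ψ ∈ V, HasHatValue ψ (suzukiZeroParam (1 - conj ρ₀)) 1 ∧
          ∀ ρ' ∈ ZetaZeros.riemannZetaNontrivialZeros, ρ' ≠ 1 - conj ρ₀ →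
            ∃ c : ℂ, HasHatValue ψ (suzukiZeroParam ρ') c ∧
              ‖c‖ ≤ ε / ‖suzukiZeroParam (1 - conj ρ₀) - suzukiZeroParam ρ'‖ ^ (1 + δ))) :
    _root_.RiemannHypothesis := by
  by_contra hRH
  obtain ⟨ρ₀, hρ₀, hoff⟩ := exists_offLine_of_not_riemannHypothesis hRH
  obtain ⟨δ, hδ, hsep⟩ := hB ρ₀ hρ₀ hoff
  exact not_offLinePairSeparation_of_weilSign hV hpos hρ₀ hoff hδ hsep

/-! ## §2 The consumed conjunct is RH-VACUOUS, for EVERY `V` -/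

/-- dbr, costume detector: under RH there is no off-line zero, so «every off-line pair is separable in `V`» holds for
EVERY `V ⊆ L²(ℝ)` — including `∅` and `{0}` — by vacuity (`re_eq_one_half_of_riemannHypothesis`); brief rh-split dbr.
[folklore] -/
theorem offLinePairSeparation_of_rh (hRH : _root_.RiemannHypothesis) (V : Set (Lp ℂ 2 (volume : Measure ℝ))) :
    ∀ ρ₀ ∈ ZetaZeros.riemannZetaNontrivialZeros, ρ₀.re ≠ 1 / 2 →
      ∃ δ : ℝ, 0 < δ ∧ ∀ ε : ℝ, 0 < ε →
        (∃ ψ ∈ V, HasHatValue ψ (suzukiZeroParam ρ₀) 1 ∧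
          ∀ ρ' ∈ ZetaZeros.riemannZetaNontrivialZeros, ρ' ≠ ρ₀ →
            ∃ c : ℂ, HasHatValue ψ (suzukiZeroParam ρ') c ∧
              ‖c‖ ≤ ε / ‖suzukiZeroParam ρ₀ - suzukiZeroParam ρ'‖ ^ (1 + δ)) ∧
        (∃ ψ ∈ V, HasHatValue ψ (suzukiZeroParam (1 - conj ρ₀)) 1 ∧
          ∀ ρ' ∈ ZetaZeros.riemannZetaNontrivialZeros, ρ' ≠ 1 - conj ρ₀ →
            ∃ c : ℂ, HasHatValue ψ (suzukiZeroParam ρ') c ∧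
              ‖c‖ ≤ ε / ‖suzukiZeroParam (1 - conj ρ₀) - suzukiZeroParam ρ'‖ ^ (1 + δ)) := by
  intro ρ₀ hρ₀ hoff
  exact absurd (re_eq_one_half_of_riemannHypothesis hRH
    (ZetaZeros.riemannZetaNontrivialZeros.zeta_eq_zero hρ₀)
    (ZetaZeros.riemannZetaNontrivialZeros.re_pos hρ₀)) hoff

/-- dbr, X-2 RE-BOOKED in consumed form: `RH ↔ (1) on V(0) ∧ «every off-line pair separable in V(0)»`; the ⟹ for
the second conjunct is VACUITY (not [Su25c] Thm 1.2 (2)), the ⟸ is the minimal door with `sub_mem_suzukiV` and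
`weilSum_re_nonneg_of_weilNormIdentityOn`; refines `CostumeDetectorsHeight.rh_iff_normIdentity_and_separation`;
brief rh-split dbr. [cite: Suzuki2025WeilHilbertSpace, Thm. 1.3 p. 3; §3.4 p. 7] -/
theorem rh_iff_normIdentityOn_and_offLinePairSeparation :
    _root_.RiemannHypothesis ↔
      WeilNormIdentityOn (suzukiV 0) ∧
        ∀ ρ₀ ∈ ZetaZeros.riemannZetaNontrivialZeros, ρ₀.re ≠ 1 / 2 →
          ∃ δ : ℝ, 0 < δ ∧ ∀ ε : ℝ, 0 < ε →
            (∃ ψ ∈ suzukiV 0, HasHatValue ψ (suzukiZeroParam ρ₀) 1 ∧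
              ∀ ρ' ∈ ZetaZeros.riemannZetaNontrivialZeros, ρ' ≠ ρ₀ →
                ∃ c : ℂ, HasHatValue ψ (suzukiZeroParam ρ') c ∧
                  ‖c‖ ≤ ε / ‖suzukiZeroParam ρ₀ - suzukiZeroParam ρ'‖ ^ (1 + δ)) ∧
            (∃ ψ ∈ suzukiV 0, HasHatValue ψ (suzukiZeroParam (1 - conj ρ₀)) 1 ∧
              ∀ ρ' ∈ ZetaZeros.riemannZetaNontrivialZeros, ρ' ≠ 1 - conj ρ₀ →
                ∃ c : ℂ, HasHatValue ψ (suzukiZeroParam ρ') c ∧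
                  ‖c‖ ≤ ε / ‖suzukiZeroParam (1 - conj ρ₀) - suzukiZeroParam ρ'‖ ^ (1 + δ)) :=
  ⟨fun h ↦ ⟨weilNormIdentityOn_suzukiV_zero_of_riemannHypothesis h, offLinePairSeparation_of_rh h _⟩,
    fun h ↦ rh_of_weilSign_of_offLinePairSeparation (fun _ hf _ hg ↦ sub_mem_suzukiV hf hg)
      (weilSum_re_nonneg_of_weilNormIdentityOn h.1) h.2⟩

/-! ## §3 ZERO-SPACE CALIBRATION: on `V = {0}` the consumed conjunct IS `RiemannHypothesis`; the printed conjuncts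
there: (1) TRUE, (2) FALSE -/

/-- dbr, costume detector: on the zero space `{0}` the consumed conjunct «every off-line pair separable» is
`RiemannHypothesis` VERBATIM — `{0}` separates nothing (`eq_zero_of_hasHatValue_zero`), so the statement says «there
is no off-line zero»; brief rh-split dbr. [folklore] -/
theorem offLinePairSeparation_singleton_zero_iff_rh :
    (∀ ρ₀ ∈ ZetaZeros.riemannZetaNontrivialZeros, ρ₀.re ≠ 1 / 2 →
      ∃ δ : ℝ, 0 < δ ∧ ∀ ε : ℝ, 0 < ε →
        (∃ ψ ∈ ({0} : Set (Lp ℂ 2 (volume : Measure ℝ))), HasHatValue ψ (suzukiZeroParam ρ₀) 1 ∧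
          ∀ ρ' ∈ ZetaZeros.riemannZetaNontrivialZeros, ρ' ≠ ρ₀ →
            ∃ c : ℂ, HasHatValue ψ (suzukiZeroParam ρ') c ∧
              ‖c‖ ≤ ε / ‖suzukiZeroParam ρ₀ - suzukiZeroParam ρ'‖ ^ (1 + δ)) ∧
        (∃ ψ ∈ ({0} : Set (Lp ℂ 2 (volume : Measure ℝ))), HasHatValue ψ (suzukiZeroParam (1 - conj ρ₀)) 1 ∧
          ∀ ρ' ∈ ZetaZeros.riemannZetaNontrivialZeros, ρ' ≠ 1 - conj ρ₀ →
            ∃ c : ℂ, HasHatValue ψ (suzukiZeroParam ρ') c ∧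
              ‖c‖ ≤ ε / ‖suzukiZeroParam (1 - conj ρ₀) - suzukiZeroParam ρ'‖ ^ (1 + δ))) ↔
      _root_.RiemannHypothesis := by
  constructor
  · intro hB
    by_contra hRH
    obtain ⟨ρ₀, hρ₀, hoff⟩ := exists_offLine_of_not_riemannHypothesis hRH
    obtain ⟨δ, -, h⟩ := hB ρ₀ hρ₀ hoff
    obtain ⟨ψ, hψ, h1, -⟩ := (h 1 one_pos).1
    rw [Set.mem_singleton_iff] at hψ
    subst hψ
    exact one_ne_zero (eq_zero_of_hasHatValue_zero h1)
  · exact fun h ↦ offLinePairSeparation_of_rh h _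

/-- dbr: conjunct (1) (the Weil norm identity) HOLDS on `{0}` — every hat-value of the zero class is `0`, so the Weil
family vanishes termwise and sums to `2‖0‖² = 0`; brief rh-split dbr. [folklore] -/
theorem weilNormIdentityOn_singleton_zero :
    WeilNormIdentityOn ({0} : Set (Lp ℂ 2 (volume : Measure ℝ))) := by
  intro ψ hψ c hc
  rw [Set.mem_singleton_iff] at hψ
  subst hψ
  have hzero : ∀ ρ : ZetaZeros.riemannZetaNontrivialZeros, c (suzukiZeroParam (ρ : ℂ)) = 0 :=
    fun ρ ↦ eq_zero_of_hasHatValue_zero (hc ρ ρ.2)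
  have h2 : (((2 * ‖(0 : Lp ℂ 2 (volume : Measure ℝ))‖ ^ 2 : ℝ)) : ℂ) = 0 := by simp
  rw [h2]
  convert (hasSum_zero : HasSum (fun _ : ZetaZeros.riemannZetaNontrivialZeros ↦ (0 : ℂ)) 0) using 1
  funext ρ
  simp [hzero ρ]

/-- dbr: the PRINTED conjunct (2) is FALSE on `{0}` (it produces a nonzero element at any zero,
`exists_ne_zero_of_zeroSeparationOn`; a non-trivial zero exists, `infinite_riemannZetaNontrivialZeros`) — so
`X-2({0})` as printed is false while its consumed form `(1)({0}) ∧ OffSep({0})` is `True ∧ RH`; brief rh-split dbr.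
[cite: Suzuki2025WeilHilbertSpace, Thm. 1.3 (2), p. 3] -/
theorem not_zeroSeparationOn_singleton_zero :
    ¬ ZeroSeparationOn ({0} : Set (Lp ℂ 2 (volume : Measure ℝ))) := by
  intro h
  obtain ⟨ρ, hρ⟩ :=
    Literature.Analysis.UnboundedOperators.infinite_riemannZetaNontrivialZeros.nonempty
  obtain ⟨ψ, hψ, hne⟩ := exists_ne_zero_of_zeroSeparationOn h hρ
  exact hne (Set.mem_singleton_iff.mp hψ)

/-- dbr: what the printed (2) adds beyond the consumed part is separation at the CRITICAL zeros (real parameters),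
which already FAILS on `{0}` at one Hardy zero (`hardy_infinite_zeros_on_critical_line_holds`) and which the door
never uses; brief rh-split dbr. [cite: Suzuki2025WeilHilbertSpace, §3.4 p. 7 (necessity via the basis ψ_γ)] -/
theorem not_critSeparation_singleton_zero (δ : ℝ) :
    ¬ ∀ ρ ∈ ZetaZeros.riemannZetaNontrivialZeros, ρ.re = 1 / 2 → ∀ ε : ℝ, 0 < ε →
        ∃ ψ ∈ ({0} : Set (Lp ℂ 2 (volume : Measure ℝ))), HasHatValue ψ (suzukiZeroParam ρ) 1 ∧
          ∀ ρ' ∈ ZetaZeros.riemannZetaNontrivialZeros, ρ' ≠ ρ →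
            ∃ c : ℂ, HasHatValue ψ (suzukiZeroParam ρ') c ∧
              ‖c‖ ≤ ε / ‖suzukiZeroParam ρ - suzukiZeroParam ρ'‖ ^ (1 + δ) := by
  intro h
  obtain ⟨t, ht⟩ := (hardy_infinite_zeros_on_critical_line_holds).nonempty
  have hρ : (1 / 2 + t * I : ℂ) ∈ ZetaZeros.riemannZetaNontrivialZeros :=
    ZetaZeros.riemannZetaNontrivialZeros.mem_of_re_pos ht (by simp)
  obtain ⟨ψ, hψ, h1, -⟩ := h _ hρ (by simp) 1 one_pos
  rw [Set.mem_singleton_iff] at hψ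
  subst hψ
  exact one_ne_zero (eq_zero_of_hasHatValue_zero h1)

/-! ## §4 [Su25c] Thm 3.1 (V-EXISTENTIAL variant) in consumed form: the witness under RH is `V = {0}` -/

/-- dbr, costume detector: `RH ↔ ∃ V` (closed under subtraction) carrying (1) and «every off-line pair separable in
`V`» — and under RH the witness is the ZERO SUBSPACE `{0}`, not the de Branges space `V(0)`: the printed Thm 3.1 needs
`V(0)` and Thm 1.2 only for the necessity of the UNUSED critical part of (2); brief rh-split dbr.
[cite: Suzuki2025WeilHilbertSpace, Thm. 3.1 pp. 7–8] -/
theorem rh_iff_exists_normIdentityOn_and_offLinePairSeparation :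
    _root_.RiemannHypothesis ↔
      ∃ V : Set (Lp ℂ 2 (volume : Measure ℝ)),
        (∀ f ∈ V, ∀ g ∈ V, f - g ∈ V) ∧ WeilNormIdentityOn V ∧
          ∀ ρ₀ ∈ ZetaZeros.riemannZetaNontrivialZeros, ρ₀.re ≠ 1 / 2 →
            ∃ δ : ℝ, 0 < δ ∧ ∀ ε : ℝ, 0 < ε →
              (∃ ψ ∈ V, HasHatValue ψ (suzukiZeroParam ρ₀) 1 ∧
                ∀ ρ' ∈ ZetaZeros.riemannZetaNontrivialZeros, ρ' ≠ ρ₀ →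
                  ∃ c : ℂ, HasHatValue ψ (suzukiZeroParam ρ') c ∧
                    ‖c‖ ≤ ε / ‖suzukiZeroParam ρ₀ - suzukiZeroParam ρ'‖ ^ (1 + δ)) ∧
              (∃ ψ ∈ V, HasHatValue ψ (suzukiZeroParam (1 - conj ρ₀)) 1 ∧
                ∀ ρ' ∈ ZetaZeros.riemannZetaNontrivialZeros, ρ' ≠ 1 - conj ρ₀ →
                  ∃ c : ℂ, HasHatValue ψ (suzukiZeroParam ρ') c ∧
                    ‖c‖ ≤ ε / ‖suzukiZeroParam (1 - conj ρ₀) - suzukiZeroParam ρ'‖ ^ (1 + δ)) := by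
  constructor
  · intro h
    refine ⟨{0}, ?_, weilNormIdentityOn_singleton_zero, offLinePairSeparation_of_rh h _⟩
    intro f hf g hg
    rw [Set.mem_singleton_iff] at hf hg ⊢
    rw [hf, hg, sub_zero]
  · rintro ⟨V, hV, h1, hB⟩
    exact rh_of_weilSign_of_offLinePairSeparation hV (weilSum_re_nonneg_of_weilNormIdentityOn h1) hB

/-- dbr, CONTRAST: in the PRINTED Thm 3.1 the witness can never be `{0}` ((2) fails there), so print needs `V(0)`;
brief rh-split dbr. [cite: Suzuki2025WeilHilbertSpace, Thm. 3.1 pp. 7–8] -/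
theorem printed_variant_excludes_zero_space :
    ¬ (WeilNormIdentityOn ({0} : Set (Lp ℂ 2 (volume : Measure ℝ))) ∧
        ZeroSeparationOn ({0} : Set (Lp ℂ 2 (volume : Measure ℝ)))) :=
  fun h ↦ not_zeroSeparationOn_singleton_zero h.2

/-! ## §5 PRICE FLOOR: an RH-free proof of the consumed conjunct on `V(0)` settles `V(0) ≠ {0}` -/

/-- dbr, price floor: «every off-line pair separable in `V(0)`» implies `V(0) ≠ {0}` UNCONDITIONALLY (cases on RH: the
RH branch is the tree's discharge `riemannHypothesis_iff_isolatedV0` + `exists_mem_suzukiV_ne_zero_of_zeroSeparationOn`,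
the ¬RH branch is the hypothesis at the off-line zero) — i.e. an RH-free proof of the CONSUMED conjunct would answer
Suzuki's open question (p. 3: "prove or disprove V(0) ≠ {0} unconditionally"); brief rh-split dbr.
[cite: Suzuki2025WeilHilbertSpace, §1 p. 3 L39–41] -/
theorem exists_mem_suzukiV_ne_zero_of_offLinePairSeparation
    (hB : ∀ ρ₀ ∈ ZetaZeros.riemannZetaNontrivialZeros, ρ₀.re ≠ 1 / 2 →
      ∃ δ : ℝ, 0 < δ ∧ ∀ ε : ℝ, 0 < ε →
        (∃ ψ ∈ suzukiV 0, HasHatValue ψ (suzukiZeroParam ρ₀) 1 ∧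
          ∀ ρ' ∈ ZetaZeros.riemannZetaNontrivialZeros, ρ' ≠ ρ₀ →
            ∃ c : ℂ, HasHatValue ψ (suzukiZeroParam ρ') c ∧
              ‖c‖ ≤ ε / ‖suzukiZeroParam ρ₀ - suzukiZeroParam ρ'‖ ^ (1 + δ)) ∧
        (∃ ψ ∈ suzukiV 0, HasHatValue ψ (suzukiZeroParam (1 - conj ρ₀)) 1 ∧
          ∀ ρ' ∈ ZetaZeros.riemannZetaNontrivialZeros, ρ' ≠ 1 - conj ρ₀ →
            ∃ c : ℂ, HasHatValue ψ (suzukiZeroParam ρ') c ∧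
              ‖c‖ ≤ ε / ‖suzukiZeroParam (1 - conj ρ₀) - suzukiZeroParam ρ'‖ ^ (1 + δ))) :
    ∃ ψ ∈ suzukiV 0, ψ ≠ 0 := by
  by_cases hRH : _root_.RiemannHypothesis
  · exact exists_mem_suzukiV_ne_zero_of_zeroSeparationOn (riemannHypothesis_iff_isolatedV0.mp hRH).2
  · obtain ⟨ρ₀, hρ₀, hoff⟩ := exists_offLine_of_not_riemannHypothesis hRH
    obtain ⟨δ, -, h⟩ := hB ρ₀ hρ₀ hoff
    obtain ⟨ψ, hψV, h1, -⟩ := (h 1 one_pos).1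
    refine ⟨ψ, hψV, ?_⟩
    rintro rfl
    exact one_ne_zero (eq_zero_of_hasHatValue_zero h1)

end Summit.RiemannHypothesis.RiemannHypothesis.Theorems.Splittings.CostumeDetectorsDbrOffLine

end
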